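import Literature.MathematicalPhysics.QuantumFieldTheory.Balaban1983to89.Node00.N24Glue
import Literature.MathematicalPhysics.QuantumFieldTheory.Balaban1983to89.T4DatumAssembly

/-!
# NODE N24 · binder B2 AT THE ASSEMBLED DATUM OF RECORD `T4DatumAssembly.datumOfRecord F N M` — the glue by name with the (0.20) binder
# DISCHARGED and the β-window in the machine's own β-family `M.βfun`

TRACK A (YM-PLAN §2d, node N24 of 28), seat `pub-ymgap-dag-n24-a` (-a KNIT-BY-NAME; ROSTER-D0062 row n24: «keep the glue elaborating against the
children's CURRENT statements of record AND THE DATUM D₀ OF n23»).  Third N24 module, a NEW importing one (append-only growth): it composes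
`Node00.N24Glue` (p408985: the children at a Stage-3 world of record, N01 ∕ N02 ∕ N04 by name) with seat dag-n23-a's DATUM ASSEMBLER
`T4DatumAssembly` (p409400: an `RGMachine` — β-functions, report fields, clause predicates, large-field operation `R` as DATA — realised along
NODE 00's averaging of record gives the finite-ε datum `datumOfRecord F N M`, a datum of record in the Stage-0 sense by `rfl`, whose runs are
FORWARD-GENERATED so that (0.20) holds along every in-interval run, `RGMachine.satisfiesRG_construction`).  The datum OF RECORD is
`datumOfRecord F N M₀` at NODE 00's Stage-5 machine `M₀` (definition item defn-IsRecordOfRecord₅, not here): every theorem below is stated for an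
ARBITRARY machine `M` — the explicit parameter R422 asks for — and lands on the same term the day `M₀` is defined.
THEOREMS ONLY, def-free, sorry-free, standard axioms; the CONVENTIONS OF RECORD block of `Node00.Carriers` applies.
* `N24_at_machine₃` — **(B2) `B16.EndStatementBPrinted (datumOfRecord F N M).C`** from: a Stage-3 world of record `w` on the assembled construction
  (`hC : w.C = (datumOfRecord F N M).C`), `0 < w.γ ≤ γ₀`, the TEN open children N03, N05–N13 by name, and the box bounds `w.b ≤ M.βfun ≤ w.βup` on
  `]0, γ₀]^{k+1}` (`FlowStep.BetaLowerH` — UNPRINTED, census T09.F; `FlowStep.BetaUpperH` — [Balaban1987RG1] p. 264, proof deferred).  NO `hrg` binder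
  (discharged by forward generation), NO `BetaBoundsInInterval` binder (derived through `curries`): of N24's READ-CARD whitelist only `hC`, `hγ`, `hγ₀`
  remain declared beside the children and the β-box bounds.
* `N24_stabilityB_body_machine₃` — the per-family body of route item stmt-QuantumFields-19183 at `SU(N)` for the ASSEMBLED datum (window clause by
  `Node00.window_of_finiteEpsData`; at `N = 2` the item's matrix at `F`).  Count-neutral; see the cell's vacuity chain (INBOX l.9057 ∕ l.9086 ∕ l.9117):
  the item AS TYPED over Stage 0 is junk-provable — THIS per-datum face is the one that survives the Stage-5 restatement.
ERRATUM to `Node00.N24GlueH`'s module docstring (referee ref-D READ #9, finding F-n24H-1, cosmetic): «both refinements IMPLY the whitelist binders» should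
read — `hrgI` is IMPLIED BY the whitelist's `hrg` (a weakening of the binder), while `(hlo, hhi)` IMPLY `hβ` (a strengthening, in the datum's own currency);
the theorems there are as stated.
WHICH CHILD BLOCKS at the assembled record: theorems N01 N02 N04 (by name); N03 modulo the Prop. 2.6 census; DECLARED N05–N13, the two β-box bounds
(β-side = NODE O ∕ (D1)(D4) territory), `hC` ∕ `hγ` ∕ `hγ₀` (Stage 5).  HONEST FRAMING: kernel bookkeeping over tree theorems BY NAME; N24 is a
COMPOSITE — NOT a node discharge, no count moves; one finite four-torus programme at fixed ε; NOT ℝ⁴ ∕ infinite volume ∕ OS ∕ mass gap ∕ Clay.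
-/

noncomputable section

namespace Literature.MathematicalPhysics.QuantumFieldTheory.Balaban1983to89.Node00

open DagBinding T4Continuum T4DatumAssembly

section Machine

variable (F : T4Family) (N : ℕ) [NeZero N] (M : RGMachine F (Matrix.specialUnitaryGroup (Fin N) ℂ))

/-- **N24 · (B2) AT THE ASSEMBLED DATUM OF RECORD `datumOfRecord F N M`** (every machine `M`): a Stage-3 world of record on the assembled
construction, `0 < w.γ ≤ γ₀`, the ten open children by name, and `w.b ≤ M.βfun ≤ w.βup` on the boxes `]0, γ₀]^{k+1}` give
`B16.EndStatementBPrinted (datumOfRecord F N M).C` — `T4DatumAssembly.RGMachine.endStatementBPrinted_of_nodes_construction_boxBounds` (the END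
headline with its (0.20) leaf GUARDED and discharged by forward generation, β-window through `curries`) fed with `Node00.N24_nodes_of_children₃`
(N01 ∕ N02 ∕ N04 inside by name). [cite: Balaban1989LargeFieldII, Thm 1 p.355 + p.391; Balaban1988Convergent, Cor. 3 (2.50) p.264; Balaban1987RG1, (0.17)–(0.20) pp.255–256, (1.22) p.264 (bookkeeping over the pinned form)] -/
theorem N24_at_machine₃ (w : WorldP) (hw : IsWorldOfRecord₃ w) (hC : w.C = (datumOfRecord F N M).C) (hγ : 0 < w.γ) {γ₀ : ℝ}
    (hγ₀ : w.γ ≤ γ₀)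
    (h03 : ∀ P : B12.RunParams, Dag.B6_main (leavesP w P)) (h05 : ∀ P : B12.RunParams, Dag.B8_main (leavesP w P))
    (h06 : ∀ P : B12.RunParams, Dag.B9_main (leavesP w P)) (h07 : ∀ P : B12.RunParams, Dag.B11_main (leavesP w P))
    (h08 : ∀ P : B12.RunParams, Dag.B10_main (leavesP w P)) (h09 : ∀ P : B12.RunParams, Dag.B12_main (leavesP w P))
    (h10 : ∀ P : B12.RunParams, Dag.B13_main (leavesP w P)) (h11 : ∀ P : B12.RunParams, Dag.B14_main (leavesP w P))
    (h12 : ∀ P : B12.RunParams, Dag.B15_main (leavesP w P)) (h13 : ∀ P : B12.RunParams, Dag.B16_main (leavesP w P))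
    (hlo : FlowStep.BetaLowerH w.b γ₀ M.βfun) (hhi : FlowStep.BetaUpperH w.βup γ₀ M.βfun) :
    B16.EndStatementBPrinted (datumOfRecord F N M).C := by
  rw [← hC]
  exact M.endStatementBPrinted_of_nodes_construction_boxBounds (avOfRecord F N) w hC hγ hγ₀
    (fun P => N24_nodes_of_children₃ w hw h03 h05 h06 h07 h08 h09 h10 h11 h12 h13 P) hlo hhi

/-- **The per-family body of route item `StabilityBAtRecord` at `SU(N)` FOR THE ASSEMBLED DATUM** (`∃ D, IsDatumOfRecord₀ F N D ∧
B16.EndStatementBPrinted D.C ∧ (window)`, at `N = 2` the item's matrix at `F`): witness `datumOfRecord F N M` (a Stage-0 datum of record by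
`T4DatumAssembly.isDatumOfRecord₀_datumOfRecord`, `rfl`), (B2) by `N24_at_machine₃`, the window by `Node00.window_of_finiteEpsData` (zero-step
runs — count-neutral, see the module docstring). [cite: Balaban1989LargeFieldII, Thm 1 p.355 + p.391; Balaban1987RG1, (0.3)–(0.4) p.253 (bookkeeping)] -/
theorem N24_stabilityB_body_machine₃ (w : WorldP) (hw : IsWorldOfRecord₃ w) (hC : w.C = (datumOfRecord F N M).C) (hγ : 0 < w.γ)
    {γ₀ : ℝ} (hγ₀ : w.γ ≤ γ₀)
    (h03 : ∀ P : B12.RunParams, Dag.B6_main (leavesP w P)) (h05 : ∀ P : B12.RunParams, Dag.B8_main (leavesP w P))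
    (h06 : ∀ P : B12.RunParams, Dag.B9_main (leavesP w P)) (h07 : ∀ P : B12.RunParams, Dag.B11_main (leavesP w P))
    (h08 : ∀ P : B12.RunParams, Dag.B10_main (leavesP w P)) (h09 : ∀ P : B12.RunParams, Dag.B12_main (leavesP w P))
    (h10 : ∀ P : B12.RunParams, Dag.B13_main (leavesP w P)) (h11 : ∀ P : B12.RunParams, Dag.B14_main (leavesP w P))
    (h12 : ∀ P : B12.RunParams, Dag.B15_main (leavesP w P)) (h13 : ∀ P : B12.RunParams, Dag.B16_main (leavesP w P))
    (hlo : FlowStep.BetaLowerH w.b γ₀ M.βfun) (hhi : FlowStep.BetaUpperH w.βup γ₀ M.βfun) :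
    ∃ D : FiniteEpsData F (Matrix.specialUnitaryGroup (Fin N) ℂ), IsDatumOfRecord₀ F N D ∧ B16.EndStatementBPrinted D.C ∧
      ∃ γ₁ : ℝ, 0 < γ₁ ∧ ∀ γ : ℝ, 0 < γ → γ ≤ γ₁ → ∃ P : B12.RunParams, (D.C P).flow.InInterval γ P.K :=
  ⟨datumOfRecord F N M, isDatumOfRecord₀_datumOfRecord F N M,
    N24_at_machine₃ F N M w hw hC hγ hγ₀ h03 h05 h06 h07 h08 h09 h10 h11 h12 h13 hlo hhi, window_of_finiteEpsData (datumOfRecord F N M)⟩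

end Machine

end Literature.MathematicalPhysics.QuantumFieldTheory.Balaban1983to89.Node00

end
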